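import Literature.Analysis.FluidPDE.PeriodicCylinderNeumannWallWordsAll
import Literature.Analysis.FluidPDE.PeriodicCylinderInteriorWordsAll
import Literature.Analysis.FluidPDE.PeriodicCylinderFrameWordNorms
import Literature.Analysis.FluidPDE.Ferrari1993PressureEstimateProofs
import HarnessLib

/-!
# The standard Neumann estimate on the period cell of the cylinder: all orders

Topic `Literature/Analysis/FluidPDE`. Support file (all results proved, no definitions, no named
facts): the general-order version of `periodicCylinder_neumannEstimate`
(`Ferrari1993PressureEstimateProofs`, the order `3` of Ferrari's pressure estimate). For `L > 0` and
every `N` there is `C` such that for all `q`, `G` smooth on the closed cylinder `{r ≤ 1}`, `L`-periodic,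
with the Neumann relation `∂q/∂n = D_K q (e_r) = G` on the wall `{r = 1}`,

  `‖∇q‖_{H^{N+1}(cell)} ≤ C (‖Δq‖_{H^N(cell)} + ‖G‖_{H^{N+1}(cell)})`

(`eSobolevDomainNorm`; `periodicCylinder_neumannEstimate_all`) — the `H^k` regularity of the Neumann
problem of every order (T. Kato, C. Y. Lai, J. Funct. Anal. 56 (1984) §4 (i): "`P` maps `H^s` into
itself … by standard elliptic theory"; J.-L. Lions, E. Magenes, *Problèmes aux limites non homogènes*
I (1968), Ch. 2 Thm 5.1; for the order `3`, A. B. Ferrari, Comm. Math. Phys. 155 (1993), proof of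
Lemma 2 p. 281, "the standard estimate"), the linear input of the `H^s` theory of the Euler equations
in the periodic cylinder (named fact
`Literature.Analysis.FluidPDE.KatoLai1984_periodicCylinderUniformExistence`). Assembled exactly as the
order-`3` theorem from the general-order pieces: the base estimate (`PeriodicCylinderNeumannGradient`),
the frame words of every length by the data (`PeriodicCylinderNeumannFrameWordsAll`), the frame
inversion near the wall (`PeriodicCylinderNeumannWallWordsAll`), the interior regularity
(`PeriodicCylinderInteriorWordsAll`), and the conversions between the sizes and the tree's Sobolev word
sums (`PeriodicCylinderFrameWordNorms`, `PeriodicCylinderWordNorms`):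

* `exists_cellL2_cylGrad_le_wordSums_all` — `‖∇q‖ ≤ C (𝒩_N(Δ_K q) + 𝒩_{N+1}(G))`;
* `exists_wordSum_cylGrad_le_of_neumann_all` — `𝒩_{N+1}(∇_K q) ≤ C (𝒩_N(Δ_K q) + 𝒩_{N+1}(G))`;
* `periodicCylinder_neumannEstimate_all` — the statement in the tree's Sobolev norms.

Mathlib/tree search: `lean search 'neumannEstimate'` — only the order `3`.

## References

* T. Kato, C. Y. Lai, J. Funct. Anal. 56 (1984) 15–28, §4 (i). [KatoLai1984]
* J.-L. Lions, E. Magenes, *Problèmes aux limites non homogènes et applications* I (1968), Ch. 2,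
  Thm 5.1. [LionsMagenes1968]
* A. B. Ferrari, Comm. Math. Phys. 155 (1993), Lemma 2 pp. 280–281. [Ferrari1993]
-/

noncomputable section

open MeasureTheory Set Function Filter Topology TopologicalSpace WithLp Metric
open scoped ContDiff NNReal ENNReal InnerProductSpace RealInnerProductSpace Laplacian

namespace Literature.Analysis.FluidPDE

open Literature.Analysis.FunctionSpaces

/-- Local notation for physical space `ℝ³ = EuclideanSpace ℝ (Fin 3)`. -/
local notation "ℝ³" => EuclideanSpace ℝ (Fin 3)

/-- Local notation for the closed unit cylinder `{r ≤ 1}`. -/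
local notation "𝕂" => closure (SetLike.coe unitCylinder : Set (EuclideanSpace ℝ (Fin 3)))

/-! ### The gradient by the word sums, every order -/

/-- **The gradient by the word sums** (base Neumann estimate): for `L > 0` and every `N` there is `C`
with `cellL2 (∇q) ≤ C (𝒩_N(Δ_K q) + 𝒩_{N+1}(G))` for all smooth periodic `q`, `G` with `x_h·∇q = G`
on the wall (verbatim the order-`3` proof). [folklore] -/
theorem exists_cellL2_cylGrad_le_wordSums_all {L : ℝ} (hL : 0 < L) (N : ℕ) :
    ∃ C : ℝ, 0 ≤ C ∧ ∀ (q G : ℝ³ → ℝ), ContDiffOn ℝ ∞ q 𝕂 → ContDiffOn ℝ ∞ G 𝕂 →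
      IsAxiallyPeriodic L q → IsAxiallyPeriodic L G →
      (∀ x ∈ frontier (unitCylinder : Set ℝ³), cylDeriv (fun y => horizontalProj y) q x = G x) →
      cellL2 L (cylGrad q) ≤ C *
        ((∑ k ∈ Finset.range (N + 1), ∑ w : Fin k → Fin (Module.finrank ℝ ℝ³),
            cellL2 L (cylWord (jcWord (constWord fun j => Module.finBasis ℝ ℝ³ (w j))) (cylLap q))) +
          ∑ k ∈ Finset.range (N + 2), ∑ w : Fin k → Fin (Module.finrank ℝ ℝ³),
            cellL2 L (cylWord (jcWord (constWord fun j => Module.finBasis ℝ ℝ³ (w j))) G)) := by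
  obtain ⟨Mb, hMb⟩ : ∃ M : ℝ, M = 1 + ∑ k, ‖Module.finBasis ℝ ℝ³ k‖ := ⟨_, rfl⟩
  have hMb1 : 1 ≤ Mb := by rw [hMb]; exact le_add_of_nonneg_right (Finset.sum_nonneg fun k _ => norm_nonneg _)
  have hMbk : ∀ k, ‖Module.finBasis ℝ ℝ³ k‖ ≤ Mb := fun k => by
    rw [hMb]
    exact (Finset.single_le_sum (f := fun k => ‖Module.finBasis ℝ ℝ³ k‖) (fun _ _ => norm_nonneg _)
      (Finset.mem_univ k)).trans (le_add_of_nonneg_left zero_le_one)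
  obtain ⟨C₁, hC₁0, hC₁⟩ := exists_cellL2_cylGrad_le_of_neumann hL
  obtain ⟨K₁, hK₁0, hK₁⟩ := exists_cellL2_cylWord_jcWord_le (F := ℝ) L hMb1 hMbk 1
  refine ⟨C₁ * (2 + 3 * K₁ * Mb), by positivity, fun q G hq hG hqp hGp hN => ?_⟩
  have hN20 := wordSum_nonneg L N (cylLap q)
  have hN30 := wordSum_nonneg L (N + 1) G
  have h1 : cellL2 L (cylLap q) ≤ ∑ k ∈ Finset.range (N + 1), ∑ w : Fin k → Fin (Module.finrank ℝ ℝ³),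
      cellL2 L (cylWord (jcWord (constWord fun j => Module.finBasis ℝ ℝ³ (w j))) (cylLap q)) := cellL2_le_wordSum L N _
  have h3 : cellL2 L G ≤ ∑ k ∈ Finset.range (N + 2), ∑ w : Fin k → Fin (Module.finrank ℝ ℝ³),
      cellL2 L (cylWord (jcWord (constWord fun j => Module.finBasis ℝ ℝ³ (w j))) G) := cellL2_le_wordSum L (N + 1) _
  have h2 : cellL2 L (cylGrad G) ≤ 3 * K₁ * Mb * ∑ k ∈ Finset.range (N + 2), ∑ w : Fin k → Fin (Module.finrank ℝ ℝ³),
      cellL2 L (cylWord (jcWord (constWord fun j => Module.finBasis ℝ ℝ³ (w j))) G) := by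
    refine (cellL2_cylGrad_le_sum L hG).trans ?_
    calc ∑ i : Fin 3, cellL2 L (cylDeriv (fun _ => cylBasis i) G)
        ≤ ∑ _i : Fin 3, K₁ * Mb * ∑ k ∈ Finset.range (N + 2), ∑ w : Fin k → Fin (Module.finrank ℝ ℝ³),
            cellL2 L (cylWord (jcWord (constWord fun j => Module.finBasis ℝ ℝ³ (w j))) G) := by
          refine Finset.sum_le_sum fun i _ => ?_
          have e : cylDeriv (fun _ => cylBasis i) G = cylWord (jcWord [some (cylBasis i)]) G := rfl
          rw [e]
          refine (hK₁ _ rfl (fun v hv => ?_) G hG).trans ?_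
          · simp only [List.mem_cons, Option.some.injEq, List.not_mem_nil, or_false] at hv
            rw [hv, norm_cylBasis]; exact hMb1
          · rw [pow_one]
            exact mul_le_mul_of_nonneg_left (wordSum_mono L (by omega : 1 ≤ N + 1) G) (by positivity)
      _ = 3 * K₁ * Mb * ∑ k ∈ Finset.range (N + 2), ∑ w : Fin k → Fin (Module.finrank ℝ ℝ³),
            cellL2 L (cylWord (jcWord (constWord fun j => Module.finBasis ℝ ℝ³ (w j))) G) := by
          rw [Finset.sum_const, Finset.card_univ, Fintype.card_fin, nsmul_eq_mul]; ring
  have hKM : 0 ≤ K₁ * Mb := by positivity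
  calc cellL2 L (cylGrad q) ≤ C₁ * (cellL2 L (cylLap q) + cellL2 L (cylGrad G) + cellL2 L G) := hC₁ q G hq hG hqp hGp hN
    _ ≤ C₁ * ((2 + 3 * K₁ * Mb) * ((∑ k ∈ Finset.range (N + 1), ∑ w : Fin k → Fin (Module.finrank ℝ ℝ³),
            cellL2 L (cylWord (jcWord (constWord fun j => Module.finBasis ℝ ℝ³ (w j))) (cylLap q))) +
          ∑ k ∈ Finset.range (N + 2), ∑ w : Fin k → Fin (Module.finrank ℝ ℝ³),
            cellL2 L (cylWord (jcWord (constWord fun j => Module.finBasis ℝ ℝ³ (w j))) G))) := by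
        refine mul_le_mul_of_nonneg_left ?_ hC₁0
        nlinarith [mul_nonneg hKM hN20, mul_nonneg hKM hN30]
    _ = _ := by ring

/-! ### The standard Neumann estimate on the period cell, real form, every order -/

/-- **The standard Neumann estimate on the period cell in word sums, every order.** For `L > 0` and
every `N` there is `C` such that for all `q`, `G` smooth on the closed cylinder, `L`-periodic, with
`x_h·∇q = G` on the wall, `𝒩_{N+1}(∇_K q) ≤ C (𝒩_N(Δ_K q) + 𝒩_{N+1}(G))`. Proof (as for the order `3`):
every basis word of `∇_K q` is a sum of constant words of `q` of length `1, …, N+2`; each splits into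
its size on `{r < 1/2}` (interior regularity) and on `{r ≥ 1/2}` (frame inversion, normal form,
frame-word estimate); the sizes of the data and `‖∇q‖` are bounded by the word sums. [folklore] -/
theorem exists_wordSum_cylGrad_le_of_neumann_all {L : ℝ} (hL : 0 < L) (N : ℕ) :
    ∃ C : ℝ, 0 ≤ C ∧ ∀ (q G : ℝ³ → ℝ), ContDiffOn ℝ ∞ q 𝕂 → ContDiffOn ℝ ∞ G 𝕂 →
      IsAxiallyPeriodic L q → IsAxiallyPeriodic L G →
      (∀ x ∈ frontier (unitCylinder : Set ℝ³), cylDeriv (fun y => horizontalProj y) q x = G x) →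
      (∑ k ∈ Finset.range (N + 2), ∑ w : Fin k → Fin (Module.finrank ℝ ℝ³),
          cellL2 L (cylWord (jcWord (constWord fun j => Module.finBasis ℝ ℝ³ (w j))) (cylGrad q))) ≤
        C * ((∑ k ∈ Finset.range (N + 1), ∑ w : Fin k → Fin (Module.finrank ℝ ℝ³),
            cellL2 L (cylWord (jcWord (constWord fun j => Module.finBasis ℝ ℝ³ (w j))) (cylLap q))) +
          ∑ k ∈ Finset.range (N + 2), ∑ w : Fin k → Fin (Module.finrank ℝ ℝ³),
            cellL2 L (cylWord (jcWord (constWord fun j => Module.finBasis ℝ ℝ³ (w j))) G)) := by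
  set b := Module.finBasis ℝ ℝ³ with hb
  -- the bound for the letters
  obtain ⟨Mb, hMb⟩ : ∃ M : ℝ, M = 1 + ∑ k, ‖b k‖ := ⟨_, rfl⟩
  have hMb1 : 1 ≤ Mb := by rw [hMb]; exact le_add_of_nonneg_right (Finset.sum_nonneg fun k _ => norm_nonneg _)
  have hMbk : ∀ k, ‖b k‖ ≤ Mb := fun k => by
    rw [hMb]
    exact (Finset.single_le_sum (f := fun k => ‖b k‖) (fun _ _ => norm_nonneg _) (Finset.mem_univ k)).trans
      (le_add_of_nonneg_left zero_le_one)
  -- the constants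
  obtain ⟨C₅, hC₅0, hC₅⟩ := exists_cellL2In_half_le_all hL hMb1 N
  obtain ⟨C₆, hC₆0, hC₆⟩ := exists_annulusL2_constWord_le_all hL hMb1 N
  obtain ⟨CF, hCF0, hCF⟩ := exists_frameSize_le_wordSum (F := ℝ) L N
  obtain ⟨CT, hCT0, hCT⟩ := exists_tanSize_le_wordSum L N
  obtain ⟨Cg, hCg0, hCg⟩ := exists_cellL2_cylGrad_le_wordSums_all hL N
  obtain ⟨Nt, hNt⟩ : ∃ T : ℝ, T = ∑ m ∈ Finset.range (N + 2), ((Fintype.card (Fin m → Fin (Module.finrank ℝ ℝ³)) : ℝ) * 3) :=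
    ⟨_, rfl⟩
  have hNt0 : 0 ≤ Nt := by rw [hNt]; exact Finset.sum_nonneg fun m _ => by positivity
  set B : ℝ := C₅ * (1 + Cg) + C₆ * (2 * Cg + CF + CT + CF) with hB
  have hB0 : 0 ≤ B := by positivity
  refine ⟨Nt * B, by positivity, fun q G hq hG hqp hGp hN => ?_⟩
  -- the word sums
  obtain ⟨N2, hN2⟩ : ∃ x : ℝ, x = ∑ k ∈ Finset.range (N + 1), ∑ w : Fin k → Fin (Module.finrank ℝ ℝ³),
    cellL2 L (cylWord (jcWord (constWord fun j => b (w j))) (cylLap q)) := ⟨_, rfl⟩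
  obtain ⟨N3, hN3⟩ : ∃ x : ℝ, x = ∑ k ∈ Finset.range (N + 2), ∑ w : Fin k → Fin (Module.finrank ℝ ℝ³),
    cellL2 L (cylWord (jcWord (constWord fun j => b (w j))) G) := ⟨_, rfl⟩
  have hN20 : 0 ≤ N2 := by rw [hN2]; exact wordSum_nonneg L N _
  have hN30 : 0 ≤ N3 := by rw [hN3]; exact wordSum_nonneg L (N + 1) _
  -- the gradient and the data by the word sums
  have hgrad : cellL2 L (cylGrad q) ≤ Cg * (N2 + N3) := by rw [hN2, hN3]; exact hCg q G hq hG hqp hGp hN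
  have hF1 : frameSize L N (cylLap q) ≤ CF * N2 := by rw [hN2]; exact hCF (cylLap q) (contDiffOn_cylLap hq)
  have hT1 : tanSize L N G ≤ CT * N3 := by rw [hN3]; exact hCT G hG
  have hF2 : frameSize L N G ≤ CF * N3 := by
    refine (hCF G hG).trans ?_
    rw [hN3]
    exact mul_le_mul_of_nonneg_left (wordSum_mono L (by omega : N ≤ N + 1) G) hCF0
  have hdata : cellL2 L (cylGrad q) + frameSize L N (cylLap q) + tanSize L N G + frameSize L N G ≤
      (Cg + CF + CT + CF) * (N2 + N3) := by
    nlinarith [mul_nonneg hCF0 hN30, mul_nonneg hCT0 hN20, mul_nonneg hCF0 hN20]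
  -- one constant word of `q`
  have hone : ∀ (m : ℕ), m < N + 2 → ∀ (w : Fin m → Fin (Module.finrank ℝ ℝ³)) (i : Fin 3),
      cellL2 L (cylWord (jcWord (constWord fun j => b (w j))) (cylDeriv (fun _ => cylBasis i) q)) ≤ B * (N2 + N3) := by
    intro m hm w i
    rw [cylWord_constWord_cylDeriv_eq_constFields w (cylBasis i) q]
    set vs : List ℝ³ := (List.ofFn fun j => b (w j)).reverse ++ [cylBasis i] with hvs
    have hlen : vs.length = m + 1 := by simp [hvs]
    have hlet : ∀ v ∈ vs, ‖v‖ ≤ Mb := fun v hv =>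
      norm_le_of_mem_basisList w (cylBasis i) hMbk (by rw [norm_cylBasis]; exact hMb1) hv
    have hWc : ContinuousOn (cylWord (constFields vs) q) 𝕂 := (contDiffOn_cylWord_constFields vs hq).continuousOn
    refine (cellL2_le_interior_add_annulus L (1 / 2) hWc).trans ?_
    have hint : (eLpNorm (cylWord (constFields vs) q) 2
        (volume.restrict ((cylinderCell L : Set ℝ³) ∩ {x | cylRadius x < 1 / 2}))).toReal ≤ C₅ * (N2 + cellL2 L (cylGrad q)) := by
      have h := hC₅ q hq hqp vs (by omega) (by omega) hlet
      rw [← constFields_eq_jcWord, ← hN2] at h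
      exact h
    have hann := hC₆ q G hq hG hqp hGp hN vs (by omega) (by omega) hlet
    calc _ ≤ C₅ * (N2 + cellL2 L (cylGrad q)) +
          C₆ * ((cellL2 L (cylGrad q) + frameSize L N (cylLap q) + tanSize L N G + frameSize L N G) + cellL2 L (cylGrad q)) :=
          add_le_add hint hann
      _ ≤ C₅ * (N2 + Cg * (N2 + N3)) + C₆ * ((Cg + CF + CT + CF) * (N2 + N3) + Cg * (N2 + N3)) := by
          refine add_le_add (mul_le_mul_of_nonneg_left (by linarith) hC₅0) (mul_le_mul_of_nonneg_left ?_ hC₆0)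
          exact add_le_add hdata hgrad
      _ ≤ B * (N2 + N3) := by rw [hB]; nlinarith [mul_nonneg hC₅0 hN30, mul_nonneg hC₆0 hN30, mul_nonneg hC₆0 hN20]
  -- sum over the words of the gradient
  have hfields : ∀ (m : ℕ) (w : Fin m → Fin (Module.finrank ℝ ℝ³)), ∀ V ∈ jcWord (constWord fun j => b (w j)), ContDiff ℝ ∞ V := by
    intro m w V hV
    obtain ⟨X, -, rfl⟩ := List.mem_map.1 hV
    exact contDiff_jcField X
  rw [← hN2, ← hN3]
  calc (∑ k ∈ Finset.range (N + 2), ∑ w : Fin k → Fin (Module.finrank ℝ ℝ³), cellL2 L (cylWord (jcWord (constWord fun j => b (w j))) (cylGrad q)))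
      ≤ ∑ k ∈ Finset.range (N + 2), ∑ w : Fin k → Fin (Module.finrank ℝ ℝ³), ∑ i : Fin 3,
          cellL2 L (cylWord (jcWord (constWord fun j => b (w j))) (cylDeriv (fun _ => cylBasis i) q)) :=
        Finset.sum_le_sum fun m _ => Finset.sum_le_sum fun w _ => cellL2_cylWord_cylGrad_le L _ (hfields m w) hq
    _ ≤ ∑ k ∈ Finset.range (N + 2), ∑ _w : Fin k → Fin (Module.finrank ℝ ℝ³), ∑ _i : Fin 3, B * (N2 + N3) :=
        Finset.sum_le_sum fun m hm => Finset.sum_le_sum fun w _ => Finset.sum_le_sum fun i _ =>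
          hone m (Finset.mem_range.1 hm) w i
    _ = Nt * (B * (N2 + N3)) := by
        rw [hNt, Finset.sum_mul]
        refine Finset.sum_congr rfl fun m _ => ?_
        rw [Finset.sum_const, Finset.sum_const, Finset.card_univ, Finset.card_univ, Fintype.card_fin, nsmul_eq_mul, nsmul_eq_mul]
        ring
    _ = Nt * B * (N2 + N3) := by ring

/-! ### The standard Neumann estimate, in the tree's Sobolev norms, every order -/

/-- **The standard estimate for the Neumann problem on the period cell, every order**: for `L > 0` and
every `N` there is `C` such that for all `q`, `G` smooth on the closed cylinder and `L`-periodic with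
`∂q/∂n = G` on the wall, `‖∇q‖_{H^{N+1}(cell)} ≤ C (‖Δq‖_{H^N(cell)} + ‖G‖_{H^{N+1}(cell)})`.
[cite: KatoLai1984, §4 (i) (the Neumann problem is `H^s`-regular of every order); Ferrari1993, proof of
Lemma 2 p. 281 (order 3)] -/
theorem periodicCylinder_neumannEstimate_all (L : ℝ) (hL : 0 < L) (N : ℕ) : ∃ C : ℝ≥0, ∀ (q G : ℝ³ → ℝ),
      ContDiffOn ℝ ∞ q 𝕂 → ContDiffOn ℝ ∞ G 𝕂 → IsAxiallyPeriodic L q → IsAxiallyPeriodic L G →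
      (∀ x ∈ frontier (unitCylinder : Set ℝ³), fderivWithin ℝ q 𝕂 x (eR x) = G x) →
      eSobolevDomainNorm (N + 1) 2 (cylinderCell L) volume (gradient q) ≤
        C * (eSobolevDomainNorm N 2 (cylinderCell L) volume (Δ q) +
          eSobolevDomainNorm (N + 1) 2 (cylinderCell L) volume G) := by
  obtain ⟨C, hC0, hC⟩ := exists_wordSum_cylGrad_le_of_neumann_all hL N
  refine ⟨Real.toNNReal C, fun q G hq hG hqp hGp hN => ?_⟩
  -- the Neumann relation through the radial field
  have hN' : ∀ x ∈ frontier (unitCylinder : Set ℝ³), cylDeriv (fun y => horizontalProj y) q x = G x := by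
    intro x hx
    have h := hN x hx
    rw [eR_eq_horizontalProj_of_wall hx] at h
    rw [cylDeriv_apply]
    exact h
  have hreal := hC q G hq hG hqp hGp hN'
  -- the three norms as word sums
  have hgradK : ContDiffOn ℝ ∞ (cylGrad q) 𝕂 := contDiffOn_cylGrad hq
  have hlapK : ContDiffOn ℝ ∞ (cylLap q) 𝕂 := contDiffOn_cylLap hq
  have e1 : eSobolevDomainNorm (N + 1) 2 (cylinderCell L) volume (gradient q) =
      ENNReal.ofReal (∑ k ∈ Finset.range (N + 2), ∑ w : Fin k → Fin (Module.finrank ℝ ℝ³),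
        cellL2 L (cylWord (jcWord (constWord fun j => Module.finBasis ℝ ℝ³ (w j))) (cylGrad q))) := by
    rw [eSobolevDomainNorm_gradient_eq_cylGrad L (N + 1) hq, ← toReal_eSobolevDomainNorm_eq_wordSum L (N + 1) hgradK,
      ENNReal.ofReal_toReal (eSobolevDomainNorm_cylinderCell_lt_top L (N + 1) 2 hgradK).ne]
  have e2 : eSobolevDomainNorm N 2 (cylinderCell L) volume (Δ q) =
      ENNReal.ofReal (∑ k ∈ Finset.range (N + 1), ∑ w : Fin k → Fin (Module.finrank ℝ ℝ³),
        cellL2 L (cylWord (jcWord (constWord fun j => Module.finBasis ℝ ℝ³ (w j))) (cylLap q))) := by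
    rw [eSobolevDomainNorm_laplacian_eq_cylLap L N hq, ← toReal_eSobolevDomainNorm_eq_wordSum L N hlapK,
      ENNReal.ofReal_toReal (eSobolevDomainNorm_cylinderCell_lt_top L N 2 hlapK).ne]
  have e3 : eSobolevDomainNorm (N + 1) 2 (cylinderCell L) volume G =
      ENNReal.ofReal (∑ k ∈ Finset.range (N + 2), ∑ w : Fin k → Fin (Module.finrank ℝ ℝ³),
        cellL2 L (cylWord (jcWord (constWord fun j => Module.finBasis ℝ ℝ³ (w j))) G)) := by
    rw [← toReal_eSobolevDomainNorm_eq_wordSum L (N + 1) hG,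
      ENNReal.ofReal_toReal (eSobolevDomainNorm_cylinderCell_lt_top L (N + 1) 2 hG).ne]
  rw [e1, e2, e3, ← ENNReal.ofReal_add (wordSum_nonneg L N _) (wordSum_nonneg L (N + 1) _),
    show ((Real.toNNReal C : ℝ≥0) : ℝ≥0∞) = ENNReal.ofReal C from rfl, ← ENNReal.ofReal_mul hC0]
  exact ENNReal.ofReal_le_ofReal hreal

end Literature.Analysis.FluidPDE
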